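import Mathlib
import HarnessLib
import Summits.HubbardSuperconductivity.HubbardSuperconductivity.Theorems.KLProgrammeKLRegimeEngineV17F2ClosersVGQ
import Summits.HubbardSuperconductivity.HubbardSuperconductivity.Theorems.KLProgrammeKLRegimeEngineV17F2ClosersVGQDoors
import Summits.HubbardSuperconductivity.HubbardSuperconductivity.Theorems.KLProgrammeKLRegimeEngineIsoTupleSmallnessV3
import Summits.HubbardSuperconductivity.HubbardSuperconductivity.Theorems.KLProgrammeKLRegimeEngineV8IsoMomentRowClosers
import Summits.HubbardSuperconductivity.HubbardSuperconductivity.Theorems.KLProgrammeKLRegimeEngineV8DefsG11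

/-!
# K3 ENGINE (stmt-HubbardSuperconductivity-20437 `KLRegimeEngineV17F2`, V2 registration 27cd7ed0f55f17c0), row (c) `stub_engine_step_values`:
# (E5-F)ₙ IS DISCHARGED BY THE STUB'S OWN BINDERS — `hexIso` LEAVES THE (c) CREDIT
# (cell gate-hubbard-kl, seat hubbard-kl-k3c2-p2 g24 = the (c) value-lane closer lineage; sequel of `…ClosersVGQ` p711453 / `…VGQDoors` p711876 / `…VGQOut`)

WHY.  `…ClosersVGQ` credits row (c) modulo `hexLad / hexOut / hexIso`.  But at the V2 tokens the fourth conjunct (E5-F)ₙ needs NO producer: row (c) carries the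
class-#6 LINE `hiso : ∀ j ≤ n, IsoTupleLineBAt L M klE5AM klE5cM (klE5dM P R) P β U μ j` (fed by §C from (b)'s `IsoFirstMomentsAt` row), and this lineage's g14 closer
`KLRegimeSplit.isoTupleL1AtV17F_klEng10_of_hiso` (…IsoTupleSmallnessV3) turns the line at `j = n` into (E5-F)ₙ given the history, the CURRENT (E2″-F)ₙ and three U-door
rows — all of which row (c) has at `(klEngGeo14, klEngQ9dG klEngGeo14 P R)`: `klEngGeo8.CF + klE5CFM ≤ klEngGeo14.CF` (G8 → G11 → G13 → G14), token #14's entries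
`klEngU₀10`, `klE5uM`, `klE5RowsUG klEngGeo14 P (klEngQ9dG klEngGeo14 P R)`, token #16, the bare ball's diagonal point, and (E2″-F)ₙ = in-class (from `hexLad`, the (B1-F)
array, the smallness lines, the package line) + out-of-class (`hexOut`).
* §1 `rowsSmallness_klEng14Q9dG`, **`isoTupleL1AtV17F_klEng14Q9dG_of_hiso`** — (E5-F)ₙ at the V2 tokens from `hiso` at `j = n` + history + (E2″-F)ₙ + row (c)'s doors;
* §2 **`stub_engine_step_values_of_producers₂ hexLad hexOut`** (ns `…EngineV8.A24a1G14`) — row (c) of the V2 image VERBATIM modulo TWO rows (the sibling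
  `…ClosersVGQPkg` composes it with `…ClosersVGQOut`'s `rowC_hexOut_of_pkg`: `stub_engine_step_values_of_producers_pkg₂ hexLad hexOutPkg`).
So the (c) credit reads `A24a1G14.stub_engine_step_values_of_producers₂ hexLad hexOut`: residual = (E2-F2)ₙ [class #5 + E1 `htower`] and the out-of-class half of (E2″-F)ₙ
[this lane's head modulo the ∃-package of E1 / class #5 / p2 rows, `…ClosersVGQOut`].  Plumbing over landed lemmas; the two rows are HYPOTHESES; nothing here asserts (c), any open row of 20437, K3 or
superconductivity.  0 kit · 0 lit.
-/

noncomputable section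

namespace Summit.HubbardSuperconductivity.HubbardSuperconductivity.Theorems.EngineV8

set_option linter.dupNamespace false -- summit = problem name (single-conjunct summit), D-0017

open Real Set Finset Complex Matrix Literature.MathematicalPhysics.QuantumLattice GrassmannAlgebra
open Literature.Probability.LatticeModels hiding torusSupNorm
open Literature.MathematicalPhysics.QuantumLattice.BandSectorCounting
open Summit.HubbardSuperconductivity.HubbardSuperconductivity.Theorems.KLProgrammeLegKernels
open Summit.HubbardSuperconductivity.HubbardSuperconductivity.Theorems.KLRegimeWick
open Summit.HubbardSuperconductivity.HubbardSuperconductivity.Theorems.TwoPointAssembly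
open Summit.HubbardSuperconductivity.HubbardSuperconductivity.Theorems.DispersionFlow
open Summit.HubbardSuperconductivity.HubbardSuperconductivity.Theorems.PerturbedFermiCurve
open Summit.HubbardSuperconductivity.HubbardSuperconductivity.Theorems.KLRegimeSplit

/-! ## §1 (E5-F)ₙ at the V2 tokens from the stub's own binders + (E2″-F)ₙ -/

/-- `klEngGeo8.CF + klE5CFM ≤ klEngGeo14.CF` (G8 → G11 → G13 → G14). -/
theorem klEngGeo8_CF_add_klE5CFM_le_klEngGeo14_CF : klEngGeo8.CF + klE5CFM ≤ klEngGeo14.CF :=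
  (klEngGeo8_CF_add_klE5CFM_le_klEngGeo11_CF.trans klEngGeo11_CF_le_klEngGeo13_CF).trans klEngGeo13_CF_le_klEngGeo14_CF

/-- **Input (III) (the accumulated-rows smallness) at `(klEngGeo14, klEngQ9dG klEngGeo14 P R)`** under row (c)'s doors. -/
theorem rowsSmallness_klEng14Q9dG (P : SplitConsts) (R : RenConsts) (hP : P.WF) {c β U : ℝ} (hβ : klBetaMin ≤ β) (hU : 0 < U)
    (hUle : U ≤ klEngU₀12GQ klEngGeo14 (klEngQ9dG klEngGeo14 P R) P R c) {n L : ℕ} (hn : n ≤ nScales β + 1) (hL : klEngL₄ P R β U ≤ L) :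
    initDevBar klEngGeo14 U + legDressBarQ2 klEngGeo14 P (klEngQ9dG klEngGeo14 P R) U 0 4 +
        (3 * klEngGeo14.CF * (P.Klam * U) ^ 2 +
          ((klEngGeo14.cloc * P.Klam ^ 2 * (1 - (4 : ℝ) ^ (-klEngGeo14.θ))⁻¹ + 2 * (klEngQ9dG klEngGeo14 P R).CR * P.Klam ^ 3 * |U|) * U ^ 2 +
              ∑ j ∈ range n, (klEngQ9dG klEngGeo14 P R).CL β j / L) +
            7 / 3 * (klEngGeo14.CF * (P.Klam * U) ^ 2) + 20 * ((klEngQ9dG klEngGeo14 P R).CR * ((P.Klam * U) ^ 2 + (P.Klam * |U|) ^ 3)) +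
              4 / 3 * ((klEngQ9dG klEngGeo14 P R).CR * (P.Klam * U) ^ 2)) ≤ U / 2 :=
  rowsSmallness_of_le_klE5RowsUG klEngGeo14_wf P R hP (isRaiseOf_klEngQ9dG_klEngQ8 klEngGeo14 P R) hβ hU
    (hUle.trans (klEngU₀12GQ_le_klEngU₀10 klEngGeo14 _ P R c)) (hUle.trans (klEngU₀12GQ_le_klE5RowsUG klEngGeo14 _ P R c)) hn hL

section Iso

variable {L M : ℕ} [NeZero L] [NeZero M]

/-- **(E5-F)ₙ AT THE V2 TOKENS FROM THE STUB's OWN BINDERS** (`1 ≤ n ≤ n_β + 1`): the class-#6 line `hiso` at `j = n`, the history, the CURRENT (E2″-F)ₙ, and row (c)'s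
doors (`μ ∈ klWindowC`, `0 < U ≤ klEngU₀12GQ klEngGeo14 (klEngQ9dG klEngGeo14 P R) P R c`, `klBetaMin ≤ β`, `klEngL₄ P R β U ≤ L`) ⟹ `IsoTupleL1AtV17F L M klEngGeo14 P β U μ n`
(twin of `isoTupleL1AtV17F_klEng10_of_hiso` at `(klEngGeo14, klEngQ9dG klEngGeo14 P R)`). -/
theorem isoTupleL1AtV17F_klEng14Q9dG_of_hiso (P : SplitConsts) (R : RenConsts) (hP : P.WF) (hR : R.WF2) {c μ U β : ℝ} (hμ : μ ∈ klWindowC)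
    (hU : 0 < U) (hUle : U ≤ klEngU₀12GQ klEngGeo14 (klEngQ9dG klEngGeo14 P R) P R c) (hβ : klBetaMin ≤ β) (hL : klEngL₄ P R β U ≤ L)
    {n : ℕ} (hn1 : 1 ≤ n) (hn : n ≤ nScales β + 1)
    (hline : IsoTupleLineBAt L M klE5AM klE5cM (klE5dM P R) P β U μ n)
    (hhist : HistP klPredsV17F2 L M klEngGeo14 P (klEngQ9dG klEngGeo14 P R) R β U μ 0 n)
    (hE2'' : PairValueIncrementAtV17F L M klEngGeo14 P (klEngQ9dG klEngGeo14 P R) β U μ n) :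
    IsoTupleL1AtV17F L M klEngGeo14 P β U μ n := by
  obtain ⟨q, hq, hqq⟩ := exists_mem_klBall_zero_diag_of_klEngL₃_le (L := L) hμ hβ (klEngL₃_le_of_klEngL₄_le hL)
  have hU10 : U ≤ klEngU₀10 P R c := hUle.trans (klEngU₀12GQ_le_klEngU₀10 klEngGeo14 _ P R c)
  have hUκ : R.Gfr 0 * |U| ≤ 1 / 32 * klE0 := (gfr0_mul_abs_le_of_le_klEngU₀10 hU hU10).trans_eq (by ring)
  exact isoTupleL1AtV17F_of_klE5M_hist klEngGeo14_wf hP (klEngQ9dG_wf klEngGeo14 P R) hR hU klEngGeo8_CF_add_klE5CFM_le_klEngGeo14_CF hn1 hn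
    (hUle.trans (klEngU₀12GQ_le_klE5uM klEngGeo14 _ P R c)) hline hhist hE2'' hq hq hqq hUκ (rowsSmallness_klEng14Q9dG P R hP hβ hU hUle hn hL)

end Iso

end Summit.HubbardSuperconductivity.HubbardSuperconductivity.Theorems.EngineV8

/-! ## §2 Row (c) of the V2 image VERBATIM modulo TWO rows (`hexLad`, `hexOut` / the (c)-OUT ∃-package) -/

namespace Summit.HubbardSuperconductivity.HubbardSuperconductivity.Theorems.EngineV8.A24a1G14

set_option linter.dupNamespace false -- summit = problem name (single-conjunct summit), D-0017

open Real Set Finset Complex Matrix Literature.MathematicalPhysics.QuantumLattice GrassmannAlgebra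
open Literature.Probability.LatticeModels hiding torusSupNorm
open Literature.MathematicalPhysics.QuantumLattice.BandSectorCounting
open Summit.HubbardSuperconductivity.HubbardSuperconductivity.Theorems.KLProgrammeLegKernels
open Summit.HubbardSuperconductivity.HubbardSuperconductivity.Theorems.KLRegimeWick
open Summit.HubbardSuperconductivity.HubbardSuperconductivity.Theorems.TwoPointAssembly
open Summit.HubbardSuperconductivity.HubbardSuperconductivity.Theorems.DispersionFlow
open Summit.HubbardSuperconductivity.HubbardSuperconductivity.Theorems.PerturbedFermiCurve
open Summit.HubbardSuperconductivity.HubbardSuperconductivity.Theorems.KLRegimeSplit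
open Summit.HubbardSuperconductivity.HubbardSuperconductivity.Theorems.EngineV8

/-- **ROW (c) `stub_engine_step_values` OF THE V2 IMAGE 27cd7ed0f55f17c0 MODULO TWO ROWS** — `hexLad` ((E2-F2)ₙ) and `hexOut` (the out-of-class half of (E2″-F)ₙ),
each under row (c)'s binder prefix; the smallness lines, `Q.WF`, the package line, the (B1-F) array, the in-class half of (E2″-F)ₙ, the quartic increment AND (E5-F)ₙ
(`isoTupleL1AtV17F_klEng14Q9dG_of_hiso` on the stub's `hiso` at `j = n`) are discharged in-text.  Conclusion = the registered (c) text BYTE-VERBATIM.  NOT a stub credit: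
the two rows are HYPOTHESES. -/
theorem stub_engine_step_values_of_producers₂
    (hexLad : ∀ (P : SplitConsts) (R : RenConsts) (c : ℝ), P.WF → R.WF2 → 0 < c → c ≤ klEngC₃7GU klEngGeo14 P R →
          ∀ μ ∈ klWindowC, ∀ U : ℝ, 0 < U → U ≤ klEngU₀12GQ klEngGeo14 (klEngQ9dG klEngGeo14 P R) P R c → ∀ β : ℝ, klBetaMin ≤ β → β ≤ Real.exp (c / U ^ 2) →
            ∀ (L M : ℕ) [NeZero L] [NeZero M], klEngL₄ P R β U ≤ L → klEngM₃ β U L ≤ M →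
              ∀ n : ℕ, 1 ≤ n → n ≤ nScales β + 1 → IsKLRegime U c (-(n : ℤ)) →
                HistP klPredsV17F2 L M klEngGeo14 P (klEngQ9dG klEngGeo14 P R) R β U μ 0 n →
                  FrameOK R U (nScales β) μ (klFlowFrameU L M β U μ n) →
                    KernelNormsV4 L M P (klEngQ9dG klEngGeo14 P R) β U μ (klFlowFrameU L M β U μ n) n →
                      (∀ j ≤ n, (KernelNormsLevels L M P (klEngQ9dG klEngGeo14 P R) β U μ (klFlowFrameU L M β U μ n) j ∧
                        KernelNormsWt4 L M (klWtBudget P (klEngQ9dG klEngGeo14 P R) U j) β U μ (klFlowFrameU L M β U μ n) j)) →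
                        (∀ j ≤ n, LevelsUExportMixedAt L M (klCU2 P R (klEngQ7 P R)) P β U μ j) →
                          (∀ j ≤ n, IsoTupleLineBAt L M klE5AM klE5cM (klE5dM P R) P β U μ j) →
                            (∀ j ≤ n, PairTransferRelFamilyK5 L M klEngGeoTh P (klCT8 P R (klEngQ7 P R) klEngGeo14 klEngGeoTh) β U μ j) →
            PairLadderStepAtV17F2 L M klEngGeo14 P (klEngQ9dG klEngGeo14 P R) β U μ n)
    (hexOut : ∀ (P : SplitConsts) (R : RenConsts) (c : ℝ), P.WF → R.WF2 → 0 < c → c ≤ klEngC₃7GU klEngGeo14 P R →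
          ∀ μ ∈ klWindowC, ∀ U : ℝ, 0 < U → U ≤ klEngU₀12GQ klEngGeo14 (klEngQ9dG klEngGeo14 P R) P R c → ∀ β : ℝ, klBetaMin ≤ β → β ≤ Real.exp (c / U ^ 2) →
            ∀ (L M : ℕ) [NeZero L] [NeZero M], klEngL₄ P R β U ≤ L → klEngM₃ β U L ≤ M →
              ∀ n : ℕ, 1 ≤ n → n ≤ nScales β + 1 → IsKLRegime U c (-(n : ℤ)) →
                HistP klPredsV17F2 L M klEngGeo14 P (klEngQ9dG klEngGeo14 P R) R β U μ 0 n →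
                  FrameOK R U (nScales β) μ (klFlowFrameU L M β U μ n) →
                    KernelNormsV4 L M P (klEngQ9dG klEngGeo14 P R) β U μ (klFlowFrameU L M β U μ n) n →
                      (∀ j ≤ n, (KernelNormsLevels L M P (klEngQ9dG klEngGeo14 P R) β U μ (klFlowFrameU L M β U μ n) j ∧
                        KernelNormsWt4 L M (klWtBudget P (klEngQ9dG klEngGeo14 P R) U j) β U μ (klFlowFrameU L M β U μ n) j)) →
                        (∀ j ≤ n, LevelsUExportMixedAt L M (klCU2 P R (klEngQ7 P R)) P β U μ j) →
                          (∀ j ≤ n, IsoTupleLineBAt L M klE5AM klE5cM (klE5dM P R) P β U μ j) →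
                            (∀ j ≤ n, PairTransferRelFamilyK5 L M klEngGeoTh P (klCT8 P R (klEngQ7 P R) klEngGeo14 klEngGeoTh) β U μ j) →
            ∀ Qm : TorusSite 2 L, ¬ IsPairClassAt L Qm n → ∀ k ∈ klBall L μ 0, ∀ k' ∈ klBall L μ 0,
              ‖klPairAmplitude L M β U μ (klFlowFrameU L M β U μ n) n Qm k k' -
                  klPairAmplitude L M β U μ (klFlowFrameU L M β U μ (n - 1)) (n - 1) Qm k k'‖ ≤
                gainBar klEngGeo14 P U n (klTorusNorm L Qm) (klTorusNorm L (k - k')) (klTorusNorm L (k + k' - Qm)) +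
                  eremBar klEngGeo14 P (klEngQ9dG klEngGeo14 P R) U β L (n - 1) + thermalBar klEngGeo14 P U β n +
                    legDressBarQ2 klEngGeo14 P (klEngQ9dG klEngGeo14 P R) U n
                      (legSliceCountT L β μ (klFlowFrameU L M β U μ n) n ![k', Qm - k', Qm - k, k]) +
                      frameShiftBar P (klEngQ9dG klEngGeo14 P R) U n) :
    ∀ (P : SplitConsts) (R : RenConsts) (c : ℝ), P.WF → R.WF2 → 0 < c → c ≤ klEngC₃7GU klEngGeo14 P R →
      ∀ μ ∈ klWindowC, ∀ U : ℝ, 0 < U → U ≤ klEngU₀12GQ klEngGeo14 (klEngQ9dG klEngGeo14 P R) P R c → ∀ β : ℝ, klBetaMin ≤ β → β ≤ Real.exp (c / U ^ 2) →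
        ∀ (L M : ℕ) [NeZero L] [NeZero M], klEngL₄ P R β U ≤ L → klEngM₃ β U L ≤ M →
          ∀ n : ℕ, 1 ≤ n → n ≤ nScales β + 1 → IsKLRegime U c (-(n : ℤ)) →
            HistP klPredsV17F2 L M klEngGeo14 P (klEngQ9dG klEngGeo14 P R) R β U μ 0 n →
              FrameOK R U (nScales β) μ (klFlowFrameU L M β U μ n) →
                KernelNormsV4 L M P (klEngQ9dG klEngGeo14 P R) β U μ (klFlowFrameU L M β U μ n) n →
                  (∀ j ≤ n, (KernelNormsLevels L M P (klEngQ9dG klEngGeo14 P R) β U μ (klFlowFrameU L M β U μ n) j ∧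
                    KernelNormsWt4 L M (klWtBudget P (klEngQ9dG klEngGeo14 P R) U j) β U μ (klFlowFrameU L M β U μ n) j)) →
                    (∀ j ≤ n, LevelsUExportMixedAt L M (klCU2 P R (klEngQ7 P R)) P β U μ j) →
                      (∀ j ≤ n, IsoTupleLineBAt L M klE5AM klE5cM (klE5dM P R) P β U μ j) →
                        (∀ j ≤ n, PairTransferRelFamilyK5 L M klEngGeoTh P (klCT8 P R (klEngQ7 P R) klEngGeo14 klEngGeoTh) β U μ j) →
                  PairLadderStepAtV17F2 L M klEngGeo14 P (klEngQ9dG klEngGeo14 P R) β U μ n ∧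
                    PairValueIncrementAtV17F L M klEngGeo14 P (klEngQ9dG klEngGeo14 P R) β U μ n ∧
                      QuarticValueIncrementAtV17F L M klEngGeo14 P (klEngQ9dG klEngGeo14 P R) β U μ n ∧
                        IsoTupleL1AtV17F L M klEngGeo14 P β U μ n := by
  intro P R c hP hR hc hc3 μ hμ U hU hUle β hβ hβc L M _ _ hL hM n hn1 hn hreg hhist hfr hV4 hlev hlevU hiso htr
  have hQ : (klEngQ9dG klEngGeo14 P R).WF := klEngQ9dG_wf klEngGeo14 P R
  have hbhi : 0 ≤ klEngGeo14.bhi := by rw [klEngGeo14_bhi_eq]; norm_num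
  have hcU' := rowC_hcU' klEngGeo14 hP hU hUle
  have hU24 : |U| * 2 ^ 24 ≤ 1 / 8 := abs_mul_two_pow_24_le_of_le_klEngU₀4 hU (hUle.trans (klEngU₀12GQ_le_klEngU₀4 klEngGeo14 _ P R c))
  have hUb : |U| * klEngGeo14.bhi ≤ 1 / 8 := by rw [klEngGeo14_bhi_eq]; exact hU24
  have hpkg : ∀ Qm : TorusSite 2 L, IsPairClassAt L Qm n →
      klEngGeo14.aplus * klEngGeo14.ζ (n - 1) + 10 * klEngGeo14.bhi ≤ klEngGeo14.ppGain n (klTorusNorm L Qm) := fun _ hQm => klg14_package_ineq_of_isPairClassAt n hQm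
  have harr : PairArrayAtV17F L M P (klEngQ9dG klEngGeo14 P R) β U μ (n - 1) :=
    (((histP_klPredsV17F2_iff L M klEngGeo14 P (klEngQ9dG klEngGeo14 P R) R β U μ 0 n).1 hhist) (n - 1) (by omega)).1.1
  have hlad := hexLad P R c hP hR hc hc3 μ hμ U hU hUle β hβ hβc L M hL hM n hn1 hn hreg hhist hfr hV4 hlev hlevU hiso htr
  have hout := hexOut P R c hP hR hc hc3 μ hμ U hU hUle β hβ hβc L M hL hM n hn1 hn hreg hhist hfr hV4 hlev hlevU hiso htr
  have hE2'' : PairValueIncrementAtV17F L M klEngGeo14 P (klEngQ9dG klEngGeo14 P R) β U μ n :=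
    klvrF_pairValueIncrementAtV17F_of_inClass_outClass (fun Qm hQm => klvrF_pairValueIncrement_inClass_G hbhi hP hQ hn1 hlad harr hcU' hUb hpkg hQm) hout
  have hE5 : IsoTupleL1AtV17F L M klEngGeo14 P β U μ n :=
    isoTupleL1AtV17F_klEng14Q9dG_of_hiso P R hP hR hμ hU hUle hβ hL hn1 hn (hiso n le_rfl) hhist hE2''
  exact klvrF_stepValues_of_reduced_G hbhi hP hQ hn1 hlad harr hcU' hUb hpkg hout hE5


end Summit.HubbardSuperconductivity.HubbardSuperconductivity.Theorems.EngineV8.A24a1G14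

end
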